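import Summits.AtomisticToContinuum.Crystallization.Theorems.ExcessDecayLiouvilleLinearSupCross

/-!
# Route `ExcessDecayLiouville`: the pointwise CROSS-SUBLATTICE bound (linear levels, VII)

Linear half of the harmonic-replacement architecture for item `ExcessDecay` (stmt-AtomisticToContinuum-9334).
From the two-point box inequality (`sup_sq_le_boxCrossSums`) and the cross level (`boxCrossSum_le`):

* `cross_block`, `weaken_mass`, `farChain2`, `farChain3`, `crossExpand_eq` : scalar bookkeeping;
* `sum3_mono`, `sup_sq_le_cubeCrossSums` : the cube form of the two-point inequality at `x₀`, `x₀ + (t 1 − t 0)`;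
* `crossBlock₀`, `crossBlock₁`, `crossBlock₂`, `crossBlock₃` : the cube cross sums of the forward differences of
  orders `0 … 3` of a field with zero operator rows, bounded by `M(g; 1280R+2388)` and `J_{10R+10}(g)`;
* `cross_sup_sq_le_of_harmonic` : for `g` finitely supported with zero operator rows on `dist · c₀ ≤ ρ_g`,
  `ρ_g ≥ 640R + 1200`, `R ≥ 2`, `x₀ ∈ S₀ ∩ B_R(c₀)`:
  `‖g x₀ − g (x₀ + (t 1 − t 0))‖² ≤ 16 L⁴ R⁻⁵ M(g; 1280R+2388) + 251 L⁴ R³ J_{10R+10}(g)`.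

All `[folklore]`; helper lemmas, nothing here closes an item.
-/

noncomputable section

namespace Summit.AtomisticToContinuum.Crystallization.Theorems.ExcessDecayLiouville

open scoped BigOperators Topology InnerProductSpace RealInnerProductSpace Classical
open Literature.MathematicalPhysics.StatisticalMechanics
open Summit.AtomisticToContinuum.Crystallization.Theorems.PhononStabilityNegative

-- Local notation: the force-constant map `K(e)w = h(|e|²)w + 2⟪e,w⟫h′(|e|²)e`.
local notation3 "𝕂[" e "] " w:max =>
  (-((‖e‖ ^ 2)⁻¹) ^ 7 + ((‖e‖ ^ 2)⁻¹) ^ 4) • w + (2 * ⟪e, w⟫ * (7 * ((‖e‖ ^ 2)⁻¹) ^ 8 - 4 * ((‖e‖ ^ 2)⁻¹) ^ 5)) • e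
set_option quotPrecheck false in
local notation "𝟙ᵇ[" x ", " c ", " R "]" => (if dist (x : EuclideanSpace ℝ (Fin 3)) c ≤ R then (1 : ℝ) else 0)
-- the three forward generators of `Λ₀` and the integer lattice vector
local notation "𝐮₁" => (triangularVec₁ 1 : EuclideanSpace ℝ (Fin 3))
local notation "𝐮₂" => (triangularVec₂ 1 : EuclideanSpace ℝ (Fin 3))
local notation "𝐰₃" => (layerNormal (2 * Real.sqrt (2 / 3)) : EuclideanSpace ℝ (Fin 3))
local notation "𝐳[" i ", " j ", " k "]" =>
  (((i : ℤ) : ℝ) • (triangularVec₁ 1 : EuclideanSpace ℝ (Fin 3)) + ((j : ℤ) : ℝ) • triangularVec₂ 1 +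
    ((k : ℤ) : ℝ) • layerNormal (2 * Real.sqrt (2 / 3)))
-- the constants of one level in mass form
local notation "Cₐ" => (19 * (1024 / ((23 / 25 : ℝ) ^ 3 * (23 / 25 : ℝ) ^ 3)) + 38 * (1024 / (23 / 25 : ℝ) ^ 3))
local notation "Cⱼ" => (9961472 : ℝ)

section

variable {t : Fin 2 → (EuclideanSpace ℝ (Fin 3))} {A : (EuclideanSpace ℝ (Fin 3)) →L[ℝ] (EuclideanSpace ℝ (Fin 3))}
  {c₀ : EuclideanSpace ℝ (Fin 3)} {κ : ℝ}

set_option quotPrecheck false in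
-- Local notation: the operator row `(L v)(p)`.
local notation "𝕃" v:max " @ " p:max =>
  tsum (fun q : Sites₀ t A => (if ((p : Sites₀ t A) : EuclideanSpace ℝ (Fin 3)) ≠ q then
    𝕂[((p : Sites₀ t A) : EuclideanSpace ℝ (Fin 3)) - q] (v ((p : Sites₀ t A) : EuclideanSpace ℝ (Fin 3)) - v q) else 0))
set_option quotPrecheck false in
-- local mass on the ball of radius `X` about the section centre `c₀`
local notation "𝐌[" f ", " X "]" =>
  tsum (fun p : Sites₀ t A => ‖f (p : EuclideanSpace ℝ (Fin 3))‖ ^ 2 * 𝟙ᵇ[p, c₀, X])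
set_option quotPrecheck false in
-- weighted far mass with floor `Y` about `c₀`
local notation "𝐉[" f ", " Y "]" =>
  tsum (fun q : Sites₀ t A => ‖f (q : EuclideanSpace ℝ (Fin 3))‖ ^ 2 * (max (dist (q : EuclideanSpace ℝ (Fin 3)) c₀) Y)⁻¹ ^ 8)
set_option quotPrecheck false in
-- lattice difference
local notation "Δ[" τ "] " f:max => (fun x : EuclideanSpace ℝ (Fin 3) => f (x + A τ) - f x)
set_option quotPrecheck false in
-- the level constant `L = (4Cₐ + 24Cⱼ)/κ + 1`
local notation "𝐋" => ((4 * Cₐ + 24 * Cⱼ) / κ + 1)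
set_option quotPrecheck false in
-- the box map based at `x₀` (a binder of each statement)
local notation "𝛗[" x₀ ", " i ", " j ", " k "]" => (x₀ + A 𝐳[((i : ℕ) : ℤ), ((j : ℕ) : ℤ), ((k : ℕ) : ℤ)])

/-! ## Scalar bookkeeping -/

/-- One block: from the cross level, the mass chain and the far-mass chain to a bound by `Mb` and `J`.
[folklore] -/
theorem cross_block {S M₁ J₁ Mb J p p' q r r' u v : ℝ} (s : S ≤ p * M₁ + q * J₁) (m : M₁ ≤ r * Mb + u * J)
    (jj : J₁ ≤ v * J) (hp : 0 ≤ p) (hpp : p ≤ p') (hq : 0 ≤ q) (hr : 0 ≤ r) (hrr : r ≤ r') (hu : 0 ≤ u)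
    (hMb : 0 ≤ Mb) (hJ : 0 ≤ J) : S ≤ p' * r' * Mb + (p' * u + q * v) * J := by
  have hp' : 0 ≤ p' := hp.trans hpp
  have h1 : p * M₁ ≤ p' * (r' * Mb + u * J) :=
    calc p * M₁ ≤ p * (r * Mb + u * J) := mul_le_mul_of_nonneg_left m hp
      _ ≤ p' * (r * Mb + u * J) := mul_le_mul_of_nonneg_right hpp (by positivity)
      _ ≤ p' * (r' * Mb + u * J) := by gcongr
  have h2 : q * J₁ ≤ q * (v * J) := mul_le_mul_of_nonneg_left jj hq
  nlinarith

/-- Weakening the mass in a chain bound. [folklore] -/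
theorem weaken_mass {M₁ M₂ Mb J r u : ℝ} (m : M₁ ≤ r * M₂ + u * J) (hM : M₂ ≤ Mb) (hr : 0 ≤ r) :
    M₁ ≤ r * Mb + u * J := by nlinarith [mul_le_mul_of_nonneg_left hM hr]

/-- Two far-mass steps. [folklore] -/
theorem farChain2 {a b c : ℝ} (h1 : a ≤ 6 * b) (h2 : b ≤ 6 * c) : a ≤ 36 * c := by linarith

/-- Three far-mass steps. [folklore] -/
theorem farChain3 {a b c d : ℝ} (h1 : a ≤ 6 * b) (h2 : b ≤ 6 * c) (h3 : c ≤ 6 * d) : a ≤ 216 * d := by linarith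

/-! ## The cube form and the cross blocks -/

/-- Monotonicity of nested box sums in the ranges. [folklore] -/
theorem sum3_mono {a b c a' b' c' : ℕ} (ha : a ≤ a') (hb : b ≤ b') (hc : c ≤ c')
    (F : ℕ → ℕ → ℕ → EuclideanSpace ℝ (Fin 3)) :
    ∑ k ∈ Finset.range a, ∑ i ∈ Finset.range b, ∑ j ∈ Finset.range c, ‖F i j k‖ ^ 2 ≤
      ∑ k ∈ Finset.range a', ∑ i ∈ Finset.range b', ∑ j ∈ Finset.range c', ‖F i j k‖ ^ 2 := by
  have h3 : ∀ k i, ∑ j ∈ Finset.range c, ‖F i j k‖ ^ 2 ≤ ∑ j ∈ Finset.range c', ‖F i j k‖ ^ 2 := fun k i =>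
    Finset.sum_le_sum_of_subset_of_nonneg (Finset.range_subset_range.2 hc) fun _ _ _ => sq_nonneg _
  have h2 : ∀ k, ∑ i ∈ Finset.range b, ∑ j ∈ Finset.range c, ‖F i j k‖ ^ 2 ≤
      ∑ i ∈ Finset.range b', ∑ j ∈ Finset.range c', ‖F i j k‖ ^ 2 := fun k =>
    (Finset.sum_le_sum fun i _ => h3 k i).trans
      (Finset.sum_le_sum_of_subset_of_nonneg (Finset.range_subset_range.2 hb) fun _ _ _ =>
        Finset.sum_nonneg fun _ _ => sq_nonneg _)
  exact (Finset.sum_le_sum fun k _ => h2 k).trans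
    (Finset.sum_le_sum_of_subset_of_nonneg (Finset.range_subset_range.2 ha) fun _ _ _ =>
      Finset.sum_nonneg fun _ _ => Finset.sum_nonneg fun _ _ => sq_nonneg _)

/-- **Cube form of the two-point box inequality** at `x₀` and `x₀ + (t 1 − t 0)`: all eight sums over the full
cube `i, j, k ≤ ⌊R⌋`. [folklore] -/
theorem sup_sq_le_cubeCrossSums (g : (EuclideanSpace ℝ (Fin 3)) → (EuclideanSpace ℝ (Fin 3)))
    (x₀ : EuclideanSpace ℝ (Fin 3)) {R : ℝ} (hR : 1 ≤ R) :
    ‖g x₀ - g (x₀ + (t 1 - t 0))‖ ^ 2 ≤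
      8 / R ^ 3 * (∑ k ∈ Finset.range (⌊R⌋₊ + 1), ∑ i ∈ Finset.range (⌊R⌋₊ + 1), ∑ j ∈ Finset.range (⌊R⌋₊ + 1),
        ‖g 𝛗[x₀, i, j, k] - g (𝛗[x₀, i, j, k] + (t 1 - t 0))‖ ^ 2) +
      8 / R * ((∑ k ∈ Finset.range (⌊R⌋₊ + 1), ∑ i ∈ Finset.range (⌊R⌋₊ + 1), ∑ j ∈ Finset.range (⌊R⌋₊ + 1),
        ‖(Δ[𝐮₁] g) 𝛗[x₀, i, j, k] - (Δ[𝐮₁] g) (𝛗[x₀, i, j, k] + (t 1 - t 0))‖ ^ 2) +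
        (∑ k ∈ Finset.range (⌊R⌋₊ + 1), ∑ i ∈ Finset.range (⌊R⌋₊ + 1), ∑ j ∈ Finset.range (⌊R⌋₊ + 1),
        ‖(Δ[𝐮₂] g) 𝛗[x₀, i, j, k] - (Δ[𝐮₂] g) (𝛗[x₀, i, j, k] + (t 1 - t 0))‖ ^ 2) +
        (∑ k ∈ Finset.range (⌊R⌋₊ + 1), ∑ i ∈ Finset.range (⌊R⌋₊ + 1), ∑ j ∈ Finset.range (⌊R⌋₊ + 1),
        ‖(Δ[𝐰₃] g) 𝛗[x₀, i, j, k] - (Δ[𝐰₃] g) (𝛗[x₀, i, j, k] + (t 1 - t 0))‖ ^ 2)) +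
      8 * R * ((∑ k ∈ Finset.range (⌊R⌋₊ + 1), ∑ i ∈ Finset.range (⌊R⌋₊ + 1), ∑ j ∈ Finset.range (⌊R⌋₊ + 1),
        ‖(Δ[𝐮₂] (Δ[𝐮₁] g)) 𝛗[x₀, i, j, k] - (Δ[𝐮₂] (Δ[𝐮₁] g)) (𝛗[x₀, i, j, k] + (t 1 - t 0))‖ ^ 2) +
        (∑ k ∈ Finset.range (⌊R⌋₊ + 1), ∑ i ∈ Finset.range (⌊R⌋₊ + 1), ∑ j ∈ Finset.range (⌊R⌋₊ + 1),
        ‖(Δ[𝐰₃] (Δ[𝐮₂] g)) 𝛗[x₀, i, j, k] - (Δ[𝐰₃] (Δ[𝐮₂] g)) (𝛗[x₀, i, j, k] + (t 1 - t 0))‖ ^ 2) +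
        (∑ k ∈ Finset.range (⌊R⌋₊ + 1), ∑ i ∈ Finset.range (⌊R⌋₊ + 1), ∑ j ∈ Finset.range (⌊R⌋₊ + 1),
        ‖(Δ[𝐰₃] (Δ[𝐮₁] g)) 𝛗[x₀, i, j, k] - (Δ[𝐰₃] (Δ[𝐮₁] g)) (𝛗[x₀, i, j, k] + (t 1 - t 0))‖ ^ 2)) +
      8 * R ^ 3 * (∑ k ∈ Finset.range (⌊R⌋₊ + 1), ∑ i ∈ Finset.range (⌊R⌋₊ + 1), ∑ j ∈ Finset.range (⌊R⌋₊ + 1),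
        ‖(Δ[𝐰₃] (Δ[𝐮₂] (Δ[𝐮₁] g))) 𝛗[x₀, i, j, k] - (Δ[𝐰₃] (Δ[𝐮₂] (Δ[𝐮₁] g))) (𝛗[x₀, i, j, k] + (t 1 - t 0))‖ ^ 2) := by
  have h := sup_sq_le_boxCrossSums (A := A) g x₀ (x₀ + (t 1 - t 0)) hR
  have hφd : ∀ i j k : ℕ, 𝛗[x₀ + (t 1 - t 0), i, j, k] = 𝛗[x₀, i, j, k] + (t 1 - t 0) := fun _ _ _ => add_right_comm _ _ _
  simp only [hφd] at h
  have hR0 : 0 < R := by linarith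
  have hle : ⌊R⌋₊ ≤ ⌊R⌋₊ + 1 := Nat.le_succ _
  have key := h.trans (add_le_add (add_le_add (add_le_add (le_refl _)
    (mul_le_mul_of_nonneg_left (add_le_add (add_le_add (sum3_mono le_rfl hle le_rfl _) (sum3_mono le_rfl le_rfl hle _))
      (sum3_mono hle le_rfl le_rfl _)) (by positivity)))
    (mul_le_mul_of_nonneg_left (add_le_add (add_le_add (sum3_mono le_rfl hle hle _) (sum3_mono hle le_rfl hle _))
      (sum3_mono hle hle le_rfl _)) (by positivity)))
    (mul_le_mul_of_nonneg_left (sum3_mono hle hle hle _) (by positivity)))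
  beta_reduce
  exact key

/-- Cross block of order `0`. [folklore] -/
theorem crossBlock₀ (hA : Adm₀ A) (hI : Inner₀ t A) (hκ0 : 0 < κ)
    (hκ : ∀ v : (EuclideanSpace ℝ (Fin 3)) → (EuclideanSpace ℝ (Fin 3)), (Function.support v).Finite →
      Function.support v ⊆ Sites₀ t A → κ * nnForm t A v ≤ ∑' p : Sites₀ t A, ⟪𝕃 v @ p, v p⟫)
    {g : (EuclideanSpace ℝ (Fin 3)) → (EuclideanSpace ℝ (Fin 3))} (hg : (Function.support g).Finite)
    {R : ℝ} (hR : 2 ≤ R) {ρg : ℝ} (hρg : 640 * R + 1200 ≤ ρg)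
    (hharm : ∀ p : Sites₀ t A, dist (p : EuclideanSpace ℝ (Fin 3)) c₀ ≤ ρg → 𝕃 g @ p = 0)
    {x₀ : EuclideanSpace ℝ (Fin 3)} (hx₀ : ∃ z ∈ Λ₀, x₀ = t 0 + A z) (hxR : dist x₀ c₀ ≤ R) :
    ∑ k ∈ Finset.range (⌊R⌋₊ + 1), ∑ i ∈ Finset.range (⌊R⌋₊ + 1), ∑ j ∈ Finset.range (⌊R⌋₊ + 1),
        ‖g 𝛗[x₀, i, j, k] - g (𝛗[x₀, i, j, k] + (t 1 - t 0))‖ ^ 2 ≤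
      𝐋 / 4 / R ^ 2 * 1 * 𝐌[g, 1280 * R + 2388] + (𝐋 / 4 / R ^ 2 * 0 + 𝐋 / 24 * 1) * 𝐉[g, 10 * R + 10] := by
  have hR1 : 1 ≤ R := by linarith
  have hR0 : 0 < R := by linarith
  have hnR : (⌊R⌋₊ : ℝ) ≤ R := Nat.floor_le hR0.le
  have hX1 : (1 : ℝ) ≤ 5 * R + 8 := by linarith
  have hX₁1 : (1 : ℝ) ≤ 4 * (5 * R + 8) + 4 := by linarith
  have hXR : R ≤ 5 * R + 8 := by linarith
  have hX₁R : R ≤ 4 * (5 * R + 8) + 4 := by linarith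
  have hXn : dist x₀ c₀ + 4 * (⌊R⌋₊ : ℝ) ≤ 5 * R + 8 := by linarith
  have hY0 : (0 : ℝ) < 10 * R + 10 := by linarith
  have hY25 : (25 : ℝ) ≤ 10 * R + 10 := by linarith
  have hYX : 10 * R + 10 ≤ 2 * (5 * R + 8) + 2 := by linarith
  have hYX₁ : 10 * R + 10 ≤ 2 * (4 * (5 * R + 8) + 4) + 2 := by linarith
  obtain ⟨hL1, -, -, -⟩ := levelConst_le (κ := κ) hκ0
  have hL0 : 0 ≤ 𝐋 := by linarith
  have hMb0 : 0 ≤ 𝐌[g, 1280 * R + 2388] := mass_nonneg g _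
  have hJ0 : 0 ≤ 𝐉[g, 10 * R + 10] := farMass_nonneg g _ hY0
  have hpp : 𝐋 / 4 / (5 * R + 8) ^ 2 ≤ 𝐋 / 4 / R ^ 2 :=
    div_le_div_of_nonneg_left (by positivity) (by positivity) (pow_le_pow_left₀ hR0.le hXR 2)
  have c := boxCrossSum_le (c₀ := c₀) hA hI hκ0.le hκ (f := g) hg hx₀ (n := ⌊R⌋₊)
    le_rfl le_rfl le_rfl hXn hX1 (ρf := ρg) (by linarith) hharm hY0 hYX
  have s := crossBox_step (κ := κ) hκ0 c (mass_nonneg g _) (farMass_nonneg g _ hY0)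
  have m : 𝐌[g, 4 * (5 * R + 8) + 4] ≤ 1 * 𝐌[g, 1280 * R + 2388] + 0 * 𝐉[g, 10 * R + 10] := by
    rw [one_mul, zero_mul, add_zero]; exact mass_mono hA hI g (by linarith)
  have jj : 𝐉[g, 10 * R + 10] ≤ 1 * 𝐉[g, 10 * R + 10] := (one_mul _).symm.le
  exact cross_block s m jj (by positivity) hpp (by positivity) (by positivity) le_rfl (by positivity) hMb0 hJ0

/-- Cross block of order `1` (one forward difference). [folklore] -/
theorem crossBlock₁ (hA : Adm₀ A) (hI : Inner₀ t A) (hκ0 : 0 < κ)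
    (hκ : ∀ v : (EuclideanSpace ℝ (Fin 3)) → (EuclideanSpace ℝ (Fin 3)), (Function.support v).Finite →
      Function.support v ⊆ Sites₀ t A → κ * nnForm t A v ≤ ∑' p : Sites₀ t A, ⟪𝕃 v @ p, v p⟫)
    {g : (EuclideanSpace ℝ (Fin 3)) → (EuclideanSpace ℝ (Fin 3))} (hg : (Function.support g).Finite)
    {R : ℝ} (hR : 2 ≤ R) {ρg : ℝ} (hρg : 640 * R + 1200 ≤ ρg)
    (hharm : ∀ p : Sites₀ t A, dist (p : EuclideanSpace ℝ (Fin 3)) c₀ ≤ ρg → 𝕃 g @ p = 0)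
    {x₀ : EuclideanSpace ℝ (Fin 3)} (hx₀ : ∃ z ∈ Λ₀, x₀ = t 0 + A z) (hxR : dist x₀ c₀ ≤ R)
    {e : EuclideanSpace ℝ (Fin 3)} (he : e = 𝐮₁ ∨ e = 𝐮₂ ∨ e = 𝐰₃) :
    ∑ k ∈ Finset.range (⌊R⌋₊ + 1), ∑ i ∈ Finset.range (⌊R⌋₊ + 1), ∑ j ∈ Finset.range (⌊R⌋₊ + 1),
        ‖(Δ[e] g) 𝛗[x₀, i, j, k] - (Δ[e] g) (𝛗[x₀, i, j, k] + (t 1 - t 0))‖ ^ 2 ≤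
      𝐋 / 4 / R ^ 2 * (𝐋 / R ^ 2) * 𝐌[g, 1280 * R + 2388] + (𝐋 / 4 / R ^ 2 * 𝐋 + 𝐋 / 24 * 6) * 𝐉[g, 10 * R + 10] := by
  have hR1 : 1 ≤ R := by linarith
  have hR0 : 0 < R := by linarith
  have hnR : (⌊R⌋₊ : ℝ) ≤ R := Nat.floor_le hR0.le
  have hX1 : (1 : ℝ) ≤ 5 * R + 8 := by linarith
  have hX₁1 : (1 : ℝ) ≤ 4 * (5 * R + 8) + 4 := by linarith
  have hXR : R ≤ 5 * R + 8 := by linarith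
  have hX₁R : R ≤ 4 * (5 * R + 8) + 4 := by linarith
  have hXn : dist x₀ c₀ + 4 * (⌊R⌋₊ : ℝ) ≤ 5 * R + 8 := by linarith
  have hY0 : (0 : ℝ) < 10 * R + 10 := by linarith
  have hY25 : (25 : ℝ) ≤ 10 * R + 10 := by linarith
  have hYX : 10 * R + 10 ≤ 2 * (5 * R + 8) + 2 := by linarith
  have hYX₁ : 10 * R + 10 ≤ 2 * (4 * (5 * R + 8) + 4) + 2 := by linarith
  obtain ⟨hL1, -, -, -⟩ := levelConst_le (κ := κ) hκ0
  have hL0 : 0 ≤ 𝐋 := by linarith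
  have hMb0 : 0 ≤ 𝐌[g, 1280 * R + 2388] := mass_nonneg g _
  have hJ0 : 0 ≤ 𝐉[g, 10 * R + 10] := farMass_nonneg g _ hY0
  have hpp : 𝐋 / 4 / (5 * R + 8) ^ 2 ≤ 𝐋 / 4 / R ^ 2 :=
    div_le_div_of_nonneg_left (by positivity) (by positivity) (pow_le_pow_left₀ hR0.le hXR 2)
  have hm_e := gen_mem hA he
  have hf1 : (Function.support (Δ[e] g)).Finite := finite_support_translate_sub hg (A e)
  have hh1 := harm_diff (c₀ := c₀) hA hI hg (hm_e).1 (hm_e).2 hharm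
  have c := boxCrossSum_le (c₀ := c₀) hA hI hκ0.le hκ (f := (Δ[e] g)) hf1 hx₀ (n := ⌊R⌋₊)
    le_rfl le_rfl le_rfl hXn hX1 (ρf := ρg - 2) (by linarith) hh1 hY0 hYX
  have s := crossBox_step (κ := κ) hκ0 c (mass_nonneg (Δ[e] g) _) (farMass_nonneg (Δ[e] g) _ hY0)
  have m0 := mass_diff_le₁ (c₀ := c₀) hA hI hκ0 hκ hg (X := 4 * (5 * R + 8) + 4) hX₁1 (ρg := ρg) (by linarith) hharm he hY0 hYX₁
  have m := weaken_mass m0 (mass_mono hA hI g (by linarith) : 𝐌[g, 4 * (4 * (5 * R + 8) + 4) + 4] ≤ 𝐌[g, 1280 * R + 2388]) (by positivity)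
  have j1 := farMass_diff_le (t := t) (A := A) (c₀ := c₀) hg (hm_e).1 (hm_e).2 hY25
  have jj := j1
  exact cross_block s m jj (by positivity) hpp (by positivity) (by positivity)
    (div_le_div_of_nonneg_left hL0 (by positivity) (pow_le_pow_left₀ hR0.le hX₁R 2) : 𝐋 / (4 * (5 * R + 8) + 4) ^ 2 ≤ 𝐋 / R ^ 2) (by positivity) hMb0 hJ0

/-- Cross block of order `2` (two forward differences). [folklore] -/
theorem crossBlock₂ (hA : Adm₀ A) (hI : Inner₀ t A) (hκ0 : 0 < κ)
    (hκ : ∀ v : (EuclideanSpace ℝ (Fin 3)) → (EuclideanSpace ℝ (Fin 3)), (Function.support v).Finite →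
      Function.support v ⊆ Sites₀ t A → κ * nnForm t A v ≤ ∑' p : Sites₀ t A, ⟪𝕃 v @ p, v p⟫)
    {g : (EuclideanSpace ℝ (Fin 3)) → (EuclideanSpace ℝ (Fin 3))} (hg : (Function.support g).Finite)
    {R : ℝ} (hR : 2 ≤ R) {ρg : ℝ} (hρg : 640 * R + 1200 ≤ ρg)
    (hharm : ∀ p : Sites₀ t A, dist (p : EuclideanSpace ℝ (Fin 3)) c₀ ≤ ρg → 𝕃 g @ p = 0)
    {x₀ : EuclideanSpace ℝ (Fin 3)} (hx₀ : ∃ z ∈ Λ₀, x₀ = t 0 + A z) (hxR : dist x₀ c₀ ≤ R)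
    {e e' : EuclideanSpace ℝ (Fin 3)} (he : e = 𝐮₁ ∨ e = 𝐮₂ ∨ e = 𝐰₃) (he' : e' = 𝐮₁ ∨ e' = 𝐮₂ ∨ e' = 𝐰₃) :
    ∑ k ∈ Finset.range (⌊R⌋₊ + 1), ∑ i ∈ Finset.range (⌊R⌋₊ + 1), ∑ j ∈ Finset.range (⌊R⌋₊ + 1),
        ‖(Δ[e] (Δ[e'] g)) 𝛗[x₀, i, j, k] - (Δ[e] (Δ[e'] g)) (𝛗[x₀, i, j, k] + (t 1 - t 0))‖ ^ 2 ≤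
      𝐋 / 4 / R ^ 2 * (𝐋 ^ 2 / R ^ 4) * 𝐌[g, 1280 * R + 2388] + (𝐋 / 4 / R ^ 2 * (7 * 𝐋 ^ 2) + 𝐋 / 24 * 36) * 𝐉[g, 10 * R + 10] := by
  have hR1 : 1 ≤ R := by linarith
  have hR0 : 0 < R := by linarith
  have hnR : (⌊R⌋₊ : ℝ) ≤ R := Nat.floor_le hR0.le
  have hX1 : (1 : ℝ) ≤ 5 * R + 8 := by linarith
  have hX₁1 : (1 : ℝ) ≤ 4 * (5 * R + 8) + 4 := by linarith
  have hXR : R ≤ 5 * R + 8 := by linarith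
  have hX₁R : R ≤ 4 * (5 * R + 8) + 4 := by linarith
  have hXn : dist x₀ c₀ + 4 * (⌊R⌋₊ : ℝ) ≤ 5 * R + 8 := by linarith
  have hY0 : (0 : ℝ) < 10 * R + 10 := by linarith
  have hY25 : (25 : ℝ) ≤ 10 * R + 10 := by linarith
  have hYX : 10 * R + 10 ≤ 2 * (5 * R + 8) + 2 := by linarith
  have hYX₁ : 10 * R + 10 ≤ 2 * (4 * (5 * R + 8) + 4) + 2 := by linarith
  obtain ⟨hL1, -, -, -⟩ := levelConst_le (κ := κ) hκ0
  have hL0 : 0 ≤ 𝐋 := by linarith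
  have hMb0 : 0 ≤ 𝐌[g, 1280 * R + 2388] := mass_nonneg g _
  have hJ0 : 0 ≤ 𝐉[g, 10 * R + 10] := farMass_nonneg g _ hY0
  have hpp : 𝐋 / 4 / (5 * R + 8) ^ 2 ≤ 𝐋 / 4 / R ^ 2 :=
    div_le_div_of_nonneg_left (by positivity) (by positivity) (pow_le_pow_left₀ hR0.le hXR 2)
  have hm_e := gen_mem hA he
  have hm_ep := gen_mem hA he'
  have hf1 : (Function.support (Δ[e'] g)).Finite := finite_support_translate_sub hg (A e')
  have hf2 : (Function.support (Δ[e] (Δ[e'] g))).Finite := finite_support_translate_sub hf1 (A e)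
  have hh1 := harm_diff (c₀ := c₀) hA hI hg (hm_ep).1 (hm_ep).2 hharm
  have hh2 := harm_diff (c₀ := c₀) hA hI hf1 (hm_e).1 (hm_e).2 hh1
  have c := boxCrossSum_le (c₀ := c₀) hA hI hκ0.le hκ (f := (Δ[e] (Δ[e'] g))) hf2 hx₀ (n := ⌊R⌋₊)
    le_rfl le_rfl le_rfl hXn hX1 (ρf := ρg - 2 - 2) (by linarith) hh2 hY0 hYX
  have s := crossBox_step (κ := κ) hκ0 c (mass_nonneg (Δ[e] (Δ[e'] g)) _) (farMass_nonneg (Δ[e] (Δ[e'] g)) _ hY0)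
  have m0 := mass_diff_le₂ (c₀ := c₀) hA hI hκ0 hκ hg (X := 4 * (5 * R + 8) + 4) hX₁1 (ρg := ρg) (by linarith) hharm he he' hY25 hYX₁
  have m := weaken_mass m0 (mass_mono hA hI g (by linarith) : 𝐌[g, 16 * (4 * (5 * R + 8) + 4) + 20] ≤ 𝐌[g, 1280 * R + 2388]) (by positivity)
  have j1 := farMass_diff_le (t := t) (A := A) (c₀ := c₀) hg (hm_ep).1 (hm_ep).2 hY25
  have j2 := farMass_diff_le (t := t) (A := A) (c₀ := c₀) hf1 (hm_e).1 (hm_e).2 hY25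
  have jj := farChain2 j2 j1
  exact cross_block s m jj (by positivity) hpp (by positivity) (by positivity)
    (div_le_div_of_nonneg_left (by positivity) (by positivity) (pow_le_pow_left₀ hR0.le hX₁R 4) : 𝐋 ^ 2 / (4 * (5 * R + 8) + 4) ^ 4 ≤ 𝐋 ^ 2 / R ^ 4) (by positivity) hMb0 hJ0

/-- Cross block of order `3` (the three forward differences). [folklore] -/
theorem crossBlock₃ (hA : Adm₀ A) (hI : Inner₀ t A) (hκ0 : 0 < κ)
    (hκ : ∀ v : (EuclideanSpace ℝ (Fin 3)) → (EuclideanSpace ℝ (Fin 3)), (Function.support v).Finite →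
      Function.support v ⊆ Sites₀ t A → κ * nnForm t A v ≤ ∑' p : Sites₀ t A, ⟪𝕃 v @ p, v p⟫)
    {g : (EuclideanSpace ℝ (Fin 3)) → (EuclideanSpace ℝ (Fin 3))} (hg : (Function.support g).Finite)
    {R : ℝ} (hR : 2 ≤ R) {ρg : ℝ} (hρg : 640 * R + 1200 ≤ ρg)
    (hharm : ∀ p : Sites₀ t A, dist (p : EuclideanSpace ℝ (Fin 3)) c₀ ≤ ρg → 𝕃 g @ p = 0)
    {x₀ : EuclideanSpace ℝ (Fin 3)} (hx₀ : ∃ z ∈ Λ₀, x₀ = t 0 + A z) (hxR : dist x₀ c₀ ≤ R) :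
    ∑ k ∈ Finset.range (⌊R⌋₊ + 1), ∑ i ∈ Finset.range (⌊R⌋₊ + 1), ∑ j ∈ Finset.range (⌊R⌋₊ + 1),
        ‖(Δ[𝐰₃] (Δ[𝐮₂] (Δ[𝐮₁] g))) 𝛗[x₀, i, j, k] - (Δ[𝐰₃] (Δ[𝐮₂] (Δ[𝐮₁] g))) (𝛗[x₀, i, j, k] + (t 1 - t 0))‖ ^ 2 ≤
      𝐋 / 4 / R ^ 2 * (𝐋 ^ 3 / R ^ 6) * 𝐌[g, 1280 * R + 2388] + (𝐋 / 4 / R ^ 2 * (43 * 𝐋 ^ 3) + 𝐋 / 24 * 216) * 𝐉[g, 10 * R + 10] := by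
  have hR1 : 1 ≤ R := by linarith
  have hR0 : 0 < R := by linarith
  have hnR : (⌊R⌋₊ : ℝ) ≤ R := Nat.floor_le hR0.le
  have hX1 : (1 : ℝ) ≤ 5 * R + 8 := by linarith
  have hX₁1 : (1 : ℝ) ≤ 4 * (5 * R + 8) + 4 := by linarith
  have hXR : R ≤ 5 * R + 8 := by linarith
  have hX₁R : R ≤ 4 * (5 * R + 8) + 4 := by linarith
  have hXn : dist x₀ c₀ + 4 * (⌊R⌋₊ : ℝ) ≤ 5 * R + 8 := by linarith
  have hY0 : (0 : ℝ) < 10 * R + 10 := by linarith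
  have hY25 : (25 : ℝ) ≤ 10 * R + 10 := by linarith
  have hYX : 10 * R + 10 ≤ 2 * (5 * R + 8) + 2 := by linarith
  have hYX₁ : 10 * R + 10 ≤ 2 * (4 * (5 * R + 8) + 4) + 2 := by linarith
  obtain ⟨hL1, -, -, -⟩ := levelConst_le (κ := κ) hκ0
  have hL0 : 0 ≤ 𝐋 := by linarith
  have hMb0 : 0 ≤ 𝐌[g, 1280 * R + 2388] := mass_nonneg g _
  have hJ0 : 0 ≤ 𝐉[g, 10 * R + 10] := farMass_nonneg g _ hY0
  have hpp : 𝐋 / 4 / (5 * R + 8) ^ 2 ≤ 𝐋 / 4 / R ^ 2 :=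
    div_le_div_of_nonneg_left (by positivity) (by positivity) (pow_le_pow_left₀ hR0.le hXR 2)
  have hu : (𝐮₁ : EuclideanSpace ℝ (Fin 3)) = 𝐮₁ ∨ 𝐮₁ = 𝐮₂ ∨ 𝐮₁ = 𝐰₃ := Or.inl rfl
  have hmu := gen_mem hA hu
  have hv : (𝐮₂ : EuclideanSpace ℝ (Fin 3)) = 𝐮₁ ∨ 𝐮₂ = 𝐮₂ ∨ 𝐮₂ = 𝐰₃ := Or.inr (Or.inl rfl)
  have hmv := gen_mem hA hv
  have hw : (𝐰₃ : EuclideanSpace ℝ (Fin 3)) = 𝐮₁ ∨ 𝐰₃ = 𝐮₂ ∨ 𝐰₃ = 𝐰₃ := Or.inr (Or.inr rfl)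
  have hmw := gen_mem hA hw
  have hf1 : (Function.support (Δ[𝐮₁] g)).Finite := finite_support_translate_sub hg (A 𝐮₁)
  have hf2 : (Function.support (Δ[𝐮₂] (Δ[𝐮₁] g))).Finite := finite_support_translate_sub hf1 (A 𝐮₂)
  have hf3 : (Function.support (Δ[𝐰₃] (Δ[𝐮₂] (Δ[𝐮₁] g)))).Finite := finite_support_translate_sub hf2 (A 𝐰₃)
  have hh1 := harm_diff (c₀ := c₀) hA hI hg (hmu).1 (hmu).2 hharm
  have hh2 := harm_diff (c₀ := c₀) hA hI hf1 (hmv).1 (hmv).2 hh1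
  have hh3 := harm_diff (c₀ := c₀) hA hI hf2 (hmw).1 (hmw).2 hh2
  have c := boxCrossSum_le (c₀ := c₀) hA hI hκ0.le hκ (f := (Δ[𝐰₃] (Δ[𝐮₂] (Δ[𝐮₁] g)))) hf3 hx₀ (n := ⌊R⌋₊)
    le_rfl le_rfl le_rfl hXn hX1 (ρf := ρg - 2 - 2 - 2) (by linarith) hh3 hY0 hYX
  have s := crossBox_step (κ := κ) hκ0 c (mass_nonneg (Δ[𝐰₃] (Δ[𝐮₂] (Δ[𝐮₁] g))) _) (farMass_nonneg (Δ[𝐰₃] (Δ[𝐮₂] (Δ[𝐮₁] g))) _ hY0)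
  have m0 := mass_diff_le₃ (c₀ := c₀) hA hI hκ0 hκ hg (X := 4 * (5 * R + 8) + 4) hX₁1 (ρg := ρg) (by linarith) hharm hw hv hu hY25 hYX₁
  have m := weaken_mass m0 (mass_mono hA hI g (by linarith) : 𝐌[g, 64 * (4 * (5 * R + 8) + 4) + 84] ≤ 𝐌[g, 1280 * R + 2388]) (by positivity)
  have j1 := farMass_diff_le (t := t) (A := A) (c₀ := c₀) hg (hmu).1 (hmu).2 hY25
  have j2 := farMass_diff_le (t := t) (A := A) (c₀ := c₀) hf1 (hmv).1 (hmv).2 hY25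
  have j3 := farMass_diff_le (t := t) (A := A) (c₀ := c₀) hf2 (hmw).1 (hmw).2 hY25
  have jj := farChain3 j3 j2 j1
  exact cross_block s m jj (by positivity) hpp (by positivity) (by positivity)
    (div_le_div_of_nonneg_left (by positivity) (by positivity) (pow_le_pow_left₀ hR0.le hX₁R 6) : 𝐋 ^ 3 / (4 * (5 * R + 8) + 4) ^ 6 ≤ 𝐋 ^ 3 / R ^ 6) (by positivity) hMb0 hJ0

/-! ## The pointwise cross bound for a field with zero operator rows -/

/-- Expansion of the assembled cross bound into coefficient form. [folklore] -/
theorem crossExpand_eq (L R Mb J : ℝ) :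
    8 / R ^ 3 * (L / 4 / R ^ 2 * 1 * Mb + (L / 4 / R ^ 2 * 0 + L / 24 * 1) * J) +
      8 / R * ((L / 4 / R ^ 2 * (L / R ^ 2) * Mb + (L / 4 / R ^ 2 * L + L / 24 * 6) * J) +
        (L / 4 / R ^ 2 * (L / R ^ 2) * Mb + (L / 4 / R ^ 2 * L + L / 24 * 6) * J) +
        (L / 4 / R ^ 2 * (L / R ^ 2) * Mb + (L / 4 / R ^ 2 * L + L / 24 * 6) * J)) +
      8 * R * ((L / 4 / R ^ 2 * (L ^ 2 / R ^ 4) * Mb + (L / 4 / R ^ 2 * (7 * L ^ 2) + L / 24 * 36) * J) +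
        (L / 4 / R ^ 2 * (L ^ 2 / R ^ 4) * Mb + (L / 4 / R ^ 2 * (7 * L ^ 2) + L / 24 * 36) * J) +
        (L / 4 / R ^ 2 * (L ^ 2 / R ^ 4) * Mb + (L / 4 / R ^ 2 * (7 * L ^ 2) + L / 24 * 36) * J)) +
      8 * R ^ 3 * (L / 4 / R ^ 2 * (L ^ 3 / R ^ 6) * Mb + (L / 4 / R ^ 2 * (43 * L ^ 3) + L / 24 * 216) * J) =
      (8 / R ^ 3 * (L / 4 / R ^ 2) + 8 / R * (3 * (L ^ 2 / 4 / R ^ 4)) + 8 * R * (3 * (L ^ 3 / 4 / R ^ 6)) +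
        8 * R ^ 3 * (L ^ 4 / 4 / R ^ 8)) * Mb +
      (8 / R ^ 3 * (L / 24) + 8 / R * (3 * (L ^ 2 / 4 / R ^ 2 + L / 4)) + 8 * R * (3 * (7 * L ^ 3 / 4 / R ^ 2 + 3 * L / 2)) +
        8 * R ^ 3 * (43 * L ^ 4 / 4 / R ^ 2 + 9 * L)) * J := by
  ring

/-- **Pointwise CROSS-SUBLATTICE bound for a field with zero operator rows**: for `g` finitely supported with
zero rows on `dist · c₀ ≤ ρ_g`, `R ≥ 2`, `ρ_g ≥ 640R + 1200` and `x₀ ∈ S₀ ∩ B_R(c₀)`,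
`‖g x₀ − g (x₀ + (t 1 − t 0))‖² ≤ 16 L⁴ R⁻⁵ M(g; 1280R+2388) + 251 L⁴ R³ J_{10R+10}(g)`. [folklore] -/
theorem cross_sup_sq_le_of_harmonic (hA : Adm₀ A) (hI : Inner₀ t A) (hκ0 : 0 < κ)
    (hκ : ∀ v : (EuclideanSpace ℝ (Fin 3)) → (EuclideanSpace ℝ (Fin 3)), (Function.support v).Finite →
      Function.support v ⊆ Sites₀ t A → κ * nnForm t A v ≤ ∑' p : Sites₀ t A, ⟪𝕃 v @ p, v p⟫)
    {g : (EuclideanSpace ℝ (Fin 3)) → (EuclideanSpace ℝ (Fin 3))} (hg : (Function.support g).Finite)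
    {R : ℝ} (hR : 2 ≤ R) {ρg : ℝ} (hρg : 640 * R + 1200 ≤ ρg)
    (hharm : ∀ p : Sites₀ t A, dist (p : EuclideanSpace ℝ (Fin 3)) c₀ ≤ ρg → 𝕃 g @ p = 0)
    {x₀ : EuclideanSpace ℝ (Fin 3)} (hx₀ : ∃ z ∈ Λ₀, x₀ = t 0 + A z) (hxR : dist x₀ c₀ ≤ R) :
    ‖g x₀ - g (x₀ + (t 1 - t 0))‖ ^ 2 ≤
      16 * 𝐋 ^ 4 / R ^ 5 * 𝐌[g, 1280 * R + 2388] + 251 * 𝐋 ^ 4 * R ^ 3 * 𝐉[g, 10 * R + 10] := by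
  have hR1 : 1 ≤ R := by linarith
  have hR0 : 0 < R := by linarith
  have hY0 : (0 : ℝ) < 10 * R + 10 := by linarith
  obtain ⟨hL1, -, -, -⟩ := levelConst_le (κ := κ) hκ0
  set Mb := 𝐌[g, 1280 * R + 2388] with hMb
  set J := 𝐉[g, 10 * R + 10] with hJ
  have hMb0 : 0 ≤ Mb := mass_nonneg g _
  have hJ0 : 0 ≤ J := farMass_nonneg g _ hY0
  have hu : (𝐮₁ : EuclideanSpace ℝ (Fin 3)) = 𝐮₁ ∨ 𝐮₁ = 𝐮₂ ∨ 𝐮₁ = 𝐰₃ := Or.inl rfl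
  have hv : (𝐮₂ : EuclideanSpace ℝ (Fin 3)) = 𝐮₁ ∨ 𝐮₂ = 𝐮₂ ∨ 𝐮₂ = 𝐰₃ := Or.inr (Or.inl rfl)
  have hw : (𝐰₃ : EuclideanSpace ℝ (Fin 3)) = 𝐮₁ ∨ 𝐰₃ = 𝐮₂ ∨ 𝐰₃ = 𝐰₃ := Or.inr (Or.inr rfl)
  have base := sup_sq_le_cubeCrossSums (t := t) (A := A) g x₀ hR1
  have B0 := crossBlock₀ (c₀ := c₀) hA hI hκ0 hκ hg hR hρg hharm hx₀ hxR
  have B1 := crossBlock₁ (c₀ := c₀) hA hI hκ0 hκ hg hR hρg hharm hx₀ hxR hu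
  have B2 := crossBlock₁ (c₀ := c₀) hA hI hκ0 hκ hg hR hρg hharm hx₀ hxR hv
  have B3 := crossBlock₁ (c₀ := c₀) hA hI hκ0 hκ hg hR hρg hharm hx₀ hxR hw
  have B21 := crossBlock₂ (c₀ := c₀) hA hI hκ0 hκ hg hR hρg hharm hx₀ hxR hv hu
  have B32 := crossBlock₂ (c₀ := c₀) hA hI hκ0 hκ hg hR hρg hharm hx₀ hxR hw hv
  have B31 := crossBlock₂ (c₀ := c₀) hA hI hκ0 hκ hg hR hρg hharm hx₀ hxR hw hu
  have B321 := crossBlock₃ (c₀ := c₀) hA hI hκ0 hκ hg hR hρg hharm hx₀ hxR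
  have total := le_trans base (add_le_add (add_le_add (add_le_add
    (mul_le_mul_of_nonneg_left B0 (by positivity))
    (mul_le_mul_of_nonneg_left (add_le_add (add_le_add B1 B2) B3) (by positivity)))
    (mul_le_mul_of_nonneg_left (add_le_add (add_le_add B21 B32) B31) (by positivity)))
    (mul_le_mul_of_nonneg_left B321 (by positivity)))
  rw [crossExpand_eq] at total
  obtain ⟨hc1, hc2⟩ := crossCoeffs_le hL1 hR1
  have h1 := mul_le_mul_of_nonneg_right hc1 hMb0
  have h2 := mul_le_mul_of_nonneg_right hc2 hJ0
  linarith
end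

end Summit.AtomisticToContinuum.Crystallization.Theorems.ExcessDecayLiouville

end
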